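import Mathlib
import Summits.QuantumFields.BalabanUV.Beta.FP.RepAlgebra

/-!
# Road «FP» (binder row D1), REP∞ algebra layer — the trace is cyclic and passes through superpositions

Continuation of `FP/RepAlgebra.lean` (`HOME/b2b-balaban-beta-d1-p3/REP-DESIGN.md`, row ALG-1, first half):
* §3 helpers (`decays_of_biLoc_diag`, `abs_le_of_biLoc`) and **`tr_comp_comm`** — the trace is cyclic on bi-localised
  kernels (dominated Fubini on `ℤ^D × ℤ^D`);
* §4 **`tr_wsum`** (abstract domination) and the instance **`tr_wsum_comp`** (`K u := comp Z (T u)`, `Z` bi-localised,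
  `T u` bi-localised at `(u,u)`, bounded weights).
The bubble/tadpole expansions built on these are in `FP/RepAlgebraBubble.lean`.

Generic in the dimension `D` and the fibre `F`; [folklore] throughout; nothing about Bałaban's operators is asserted.
HONEST FRAMING: bookkeeping toward `hident` (GAPS O-asym1-7); discharges nothing of `BetaPertH`; NOT the continuum limit, NOT Clay.
-/

noncomputable section

open Finset Filter Topology
open scoped BigOperators

namespace Summit.QuantumFields.BalabanUV.Beta.FP.RepAlgebraTrace

open Literature.MathematicalPhysics.QuantumFieldTheory.Balaban1983to89
open Literature.MathematicalPhysics.QuantumFieldTheory.Balaban1983to89.B12Sec2to5 (l1 l1_nonneg summable_exp_neg_l1)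
open Literature.MathematicalPhysics.QuantumFieldTheory.Balaban1983to89.Beta.ExpKernelCalculus
open Literature.MathematicalPhysics.QuantumFieldTheory.Balaban1983to89.Beta.OneStepResolventKernel (wsum biLoc_wsum)
open Summit.QuantumFields.BalabanUV.Beta.FP.RepAlgebra

variable {D : ℕ} {F : Type*} [Fintype F]

/-! ## §3 Helpers: diagonal bi-localisation is decay; bounded entries; the trace is cyclic -/

section Helpers

omit [Fintype F] in
/-- [folklore] A kernel bi-localised at `(u,u)` decays off the diagonal with the same constants. -/
theorem decays_of_biLoc_diag {K : MKer D F} {u : Site D} {C δ : ℝ} (hK : BiLoc K u u C δ) (hδ : 0 ≤ δ) :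
    Decays K C δ := by
  intro x y a b
  have hC : 0 ≤ C := hK.nonneg a
  refine (hK x y a b).trans (mul_le_mul_of_nonneg_left (Real.exp_le_exp.2 ?_) hC)
  have := l1_sub_triangle x u y
  rw [l1_sub_symm u y] at this
  nlinarith [l1_nonneg (x - u), l1_nonneg (y - u)]

omit [Fintype F] in
/-- [folklore] A bi-localised kernel has bounded entries. -/
theorem abs_le_of_biLoc {K : MKer D F} {p q : Site D} {C δ : ℝ} (hK : BiLoc K p q C δ) (hδ : 0 ≤ δ)
    (x y : Site D) (a b : F) : |K x y a b| ≤ C := by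
  have hC : 0 ≤ C := hK.nonneg a
  refine (hK x y a b).trans ?_
  have he : Real.exp (-δ * (l1 (x - p) + l1 (y - q))) ≤ 1 := by
    rw [Real.exp_le_one_iff]; nlinarith [l1_nonneg (x - p), l1_nonneg (y - q)]
  nlinarith

/-- [folklore] **The trace is cyclic** on bi-localised kernels: `tr (comp X Y) = tr (comp Y X)`. -/
theorem tr_comp_comm {X Y : MKer D F} {p p' q' q : Site D} {CX CY δ : ℝ} (hX : BiLoc X p p' CX δ)
    (hY : BiLoc Y q' q CY δ) (hδ : 0 < δ) : tr (comp X Y) = tr (comp Y X) := by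
  classical
  rcases isEmpty_or_nonempty F with hF | ⟨⟨a₀⟩⟩
  · simp [tr, comp]
  have hCX : 0 ≤ CX := hX.nonneg a₀
  have hCY : 0 ≤ CY := hY.nonneg a₀
  -- the double family `H x y := Σ_a Σ_f X x y a f · Y y x f a` and its product majorant
  set H : Site D → Site D → ℝ := fun x y => ∑ a, ∑ f, X x y a f * Y y x f a with hH
  have hb : ∀ x y, |H x y| ≤ ((Fintype.card F : ℝ) * ((Fintype.card F : ℝ) * (CX * CY))) *
      (Real.exp (-δ * l1 (x - p)) * Real.exp (-δ * l1 (y - p'))) := by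
    intro x y
    calc |H x y| ≤ ∑ a, |∑ f, X x y a f * Y y x f a| := Finset.abs_sum_le_sum_abs _ _
      _ ≤ ∑ a, ∑ f, |X x y a f * Y y x f a| := Finset.sum_le_sum fun a _ => Finset.abs_sum_le_sum_abs _ _
      _ ≤ ∑ _a : F, ∑ _f : F, (CX * CY) * (Real.exp (-δ * l1 (x - p)) * Real.exp (-δ * l1 (y - p'))) := by
          refine Finset.sum_le_sum fun a _ => Finset.sum_le_sum fun f _ => ?_
          rw [abs_mul]
          have h1 : |X x y a f| ≤ CX * (Real.exp (-δ * l1 (x - p)) * Real.exp (-δ * l1 (y - p'))) := by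
            refine (hX x y a f).trans (le_of_eq ?_)
            rw [← Real.exp_add]; congr 1; ring
          have h2 : |Y y x f a| ≤ CY := abs_le_of_biLoc hY hδ.le y x f a
          calc |X x y a f| * |Y y x f a|
              ≤ (CX * (Real.exp (-δ * l1 (x - p)) * Real.exp (-δ * l1 (y - p')))) * CY :=
                mul_le_mul h1 h2 (abs_nonneg _) (by positivity)
            _ = (CX * CY) * (Real.exp (-δ * l1 (x - p)) * Real.exp (-δ * l1 (y - p'))) := by ring
      _ = _ := by simp only [Finset.sum_const, Finset.card_univ, nsmul_eq_mul]; ring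
  have hsum : Summable (Function.uncurry H) := by
    have hprod : Summable fun xy : Site D × Site D =>
        Real.exp (-δ * l1 (xy.1 - p)) * Real.exp (-δ * l1 (xy.2 - p')) :=
      summable_mul_of_summable_norm (f := fun x : Site D => Real.exp (-δ * l1 (x - p)))
        (g := fun y : Site D => Real.exp (-δ * l1 (y - p')))
        (by simpa only [Real.norm_eq_abs, abs_of_nonneg (Real.exp_nonneg _)] using summable_exp_shift' hδ p)
        (by simpa only [Real.norm_eq_abs, abs_of_nonneg (Real.exp_nonneg _)] using summable_exp_shift' hδ p')
    refine Summable.of_norm_bounded (hprod.mul_left ((Fintype.card F : ℝ) * ((Fintype.card F : ℝ) * (CX * CY))))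
      fun xy => ?_
    rw [Real.norm_eq_abs]
    exact hb xy.1 xy.2
  have hx : ∀ x, Summable (H x) := fun x => hsum.prod_factor x
  have hy : ∀ y, Summable fun x => H x y := fun y => hsum.prod_symm.prod_factor y
  -- per-`a` summability of the inner `y`-series (a single column pair)
  have hya : ∀ x a, Summable fun y => ∑ f, X x y a f * Y y x f a := by
    intro x a
    refine Summable.of_norm_bounded ((summable_exp_shift' hδ p').mul_left ((Fintype.card F : ℝ) * (CX * CY)))
      fun y => ?_
    rw [Real.norm_eq_abs]
    calc |∑ f, X x y a f * Y y x f a| ≤ ∑ f, |X x y a f * Y y x f a| := Finset.abs_sum_le_sum_abs _ _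
      _ ≤ ∑ _f : F, (CX * CY) * Real.exp (-δ * l1 (y - p')) := by
          refine Finset.sum_le_sum fun f _ => ?_
          rw [abs_mul]
          have h1 : |X x y a f| ≤ CX * Real.exp (-δ * l1 (y - p')) := by
            refine (hX x y a f).trans (mul_le_mul_of_nonneg_left (Real.exp_le_exp.2 ?_) hCX)
            nlinarith [l1_nonneg (x - p)]
          calc |X x y a f| * |Y y x f a| ≤ (CX * Real.exp (-δ * l1 (y - p'))) * CY :=
                mul_le_mul h1 (abs_le_of_biLoc hY hδ.le y x f a) (abs_nonneg _) (by positivity)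
            _ = (CX * CY) * Real.exp (-δ * l1 (y - p')) := by ring
      _ = _ := by simp only [Finset.sum_const, Finset.card_univ, nsmul_eq_mul]; ring
  have hxa : ∀ y f, Summable fun x => ∑ a, Y y x f a * X x y a f := by
    intro y f
    refine Summable.of_norm_bounded ((summable_exp_shift' hδ p).mul_left ((Fintype.card F : ℝ) * (CX * CY)))
      fun x => ?_
    rw [Real.norm_eq_abs]
    calc |∑ a, Y y x f a * X x y a f| ≤ ∑ a, |Y y x f a * X x y a f| := Finset.abs_sum_le_sum_abs _ _
      _ ≤ ∑ _a : F, (CX * CY) * Real.exp (-δ * l1 (x - p)) := by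
          refine Finset.sum_le_sum fun a _ => ?_
          rw [abs_mul]
          have h1 : |X x y a f| ≤ CX * Real.exp (-δ * l1 (x - p)) := by
            refine (hX x y a f).trans (mul_le_mul_of_nonneg_left (Real.exp_le_exp.2 ?_) hCX)
            nlinarith [l1_nonneg (y - p')]
          calc |Y y x f a| * |X x y a f| ≤ CY * (CX * Real.exp (-δ * l1 (x - p))) :=
                mul_le_mul (abs_le_of_biLoc hY hδ.le y x f a) h1 (abs_nonneg _) hCY
            _ = (CX * CY) * Real.exp (-δ * l1 (x - p)) := by ring
      _ = _ := by simp only [Finset.sum_const, Finset.card_univ, nsmul_eq_mul]; ring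
  -- both traces are the double sum of `H`
  have eL : tr (comp X Y) = ∑' x, ∑' y, H x y := by
    show (∑' x, ∑ a, ∑' y, ∑ f, X x y a f * Y y x f a) = ∑' x, ∑' y, H x y
    refine tsum_congr fun x => ?_
    rw [hH, Summable.tsum_finsetSum fun a _ => hya x a]
  have eR : tr (comp Y X) = ∑' y, ∑' x, H x y := by
    show (∑' y, ∑ f, ∑' x, ∑ a, Y y x f a * X x y a f) = ∑' y, ∑' x, H x y
    refine tsum_congr fun y => ?_
    rw [← Summable.tsum_finsetSum fun f _ => hxa y f]
    refine tsum_congr fun x => ?_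
    rw [hH, Finset.sum_comm]
    exact Finset.sum_congr rfl fun a _ => Finset.sum_congr rfl fun f _ => mul_comm _ _
  rw [eL, eR]
  exact (hsum.tsum_comm' hx hy).symm

end Helpers

/-! ## §4 Superpositions pass through the trace -/

section Trace

variable {K : Site D → MKer D F} {w : Site D → ℝ}

/-- [folklore] **`tr` through a superposition** (abstract domination): if every diagonal entry series `u ↦ w u · K u x x a a` is
summable and the double family `(x,u) ↦ w u · Σ_a K u x x a a` is summable, then `tr (wsum w K) = Σ'_u w u · tr (K u)`. -/
theorem tr_wsum (hent : ∀ x a, Summable fun u => w u * K u x x a a)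
    (hdom : Summable fun xu : Site D × Site D => w xu.2 * ∑ a, K xu.2 xu.1 xu.1 a a) :
    tr (wsum w K) = ∑' u, w u * tr (K u) := by
  set G : Site D → Site D → ℝ := fun x u => w u * ∑ a, K u x x a a with hG
  have hsum : Summable (Function.uncurry G) := hdom
  have hx : ∀ x, Summable (G x) := fun x => hsum.prod_factor x
  have hu : ∀ u, Summable fun x => G x u := fun u => hsum.prod_symm.prod_factor u
  have eL : tr (wsum w K) = ∑' x, ∑' u, G x u := by
    show (∑' x, ∑ a, ∑' u, w u * K u x x a a) = ∑' x, ∑' u, G x u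
    refine tsum_congr fun x => ?_
    rw [← Summable.tsum_finsetSum fun a _ => hent x a]
    refine tsum_congr fun u => ?_
    show (∑ a, w u * K u x x a a) = w u * ∑ a, K u x x a a
    rw [Finset.mul_sum]
  have eR : (∑' u, w u * tr (K u)) = ∑' u, ∑' x, G x u := by
    refine tsum_congr fun u => ?_
    show w u * (∑' x, ∑ a, K u x x a a) = ∑' x, G x u
    rw [← tsum_mul_left]
  rw [eL, eR]
  exact (hsum.tsum_comm' hx hu).symm

/-- [folklore] Domination instance for `tr_wsum`: `K u := comp Z (T u)` with `Z` bi-localised at `(p,p′)`, `T u` bi-localised at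
`(u,u)` (common rate `δ > 0`) and BOUNDED weights — the composition is exponentially small in `|p′ − u|₁`, which sums the `u`-series. -/
theorem tr_wsum_comp {Z : MKer D F} {T : Site D → MKer D F} {p p' : Site D} {CZ CT Cw δ : ℝ}
    (hZ : BiLoc Z p p' CZ δ) (hT : ∀ u, BiLoc (T u) u u CT δ) (hδ : 0 < δ) (hw : ∀ u, |w u| ≤ Cw) :
    tr (wsum w fun u => comp Z (T u)) = ∑' u, w u * tr (comp Z (T u)) := by
  classical
  rcases isEmpty_or_nonempty F with hF | ⟨⟨a₀⟩⟩
  · simp [tr, comp, wsum]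
  have hCZ : 0 ≤ CZ := hZ.nonneg a₀
  have hCT : 0 ≤ CT := (hT p).nonneg a₀
  have hCw : 0 ≤ Cw := (abs_nonneg _).trans (hw p)
  -- `comp Z (T u)` is bi-localised at `(p, u)` with a constant `∝ e^{−(δ/2)|p′−u|}`
  have hK : ∀ u, BiLoc (comp Z (T u)) p u
      ((Fintype.card F : ℝ) * (CZ * CT) * Zl D (δ / 2) * Real.exp (-(δ / 2) * l1 (p' - u))) δ :=
    fun u => biLoc_comp_biLoc hZ (hT u) hδ
  set c₀ : ℝ := (Fintype.card F : ℝ) * (CZ * CT) * Zl D (δ / 2) with hc₀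
  have hc₀nn : 0 ≤ c₀ := by rw [hc₀]; have := Zl_nonneg (D := D) (half_pos hδ); positivity
  refine tr_wsum (fun x a => ?_) ?_
  · -- entry series: `|w u · (Z∘T u) x x a a| ≤ Cw·c₀·e^{−(δ/2)|p′−u|}`
    refine Summable.of_norm_bounded ((summable_exp_shift (half_pos hδ) p').mul_left (Cw * c₀)) fun u => ?_
    rw [Real.norm_eq_abs, abs_mul]
    have h1 : |comp Z (T u) x x a a| ≤ c₀ * Real.exp (-(δ / 2) * l1 (p' - u)) := by
      refine (hK u x x a a).trans ?_
      have he : Real.exp (-δ * (l1 (x - p) + l1 (x - u))) ≤ 1 := by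
        rw [Real.exp_le_one_iff]; nlinarith [l1_nonneg (x - p), l1_nonneg (x - u)]
      have : 0 ≤ c₀ * Real.exp (-(δ / 2) * l1 (p' - u)) := by positivity
      nlinarith
    calc |w u| * |comp Z (T u) x x a a| ≤ Cw * (c₀ * Real.exp (-(δ / 2) * l1 (p' - u))) :=
          mul_le_mul (hw u) h1 (abs_nonneg _) hCw
      _ = Cw * c₀ * Real.exp (-(δ / 2) * l1 (p' - u)) := by ring
  · -- double family: `|w u · Σ_a (Z∘T u) x x a a| ≤ Cw·|F|·c₀·e^{−(δ/2)|p′−u|}·e^{−(δ/2)|x−p|}` (product majorant)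
    have hprod : Summable fun xu : Site D × Site D =>
        Real.exp (-(δ / 2) * l1 (xu.1 - p)) * Real.exp (-(δ / 2) * l1 (p' - xu.2)) :=
      summable_mul_of_summable_norm (f := fun x : Site D => Real.exp (-(δ / 2) * l1 (x - p)))
        (g := fun u : Site D => Real.exp (-(δ / 2) * l1 (p' - u)))
        (by simpa only [Real.norm_eq_abs, abs_of_nonneg (Real.exp_nonneg _)] using summable_exp_shift' (half_pos hδ) p)
        (by simpa only [Real.norm_eq_abs, abs_of_nonneg (Real.exp_nonneg _)] using summable_exp_shift (half_pos hδ) p')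
    refine Summable.of_norm_bounded (hprod.mul_left (Cw * ((Fintype.card F : ℝ) * c₀))) fun xu => ?_
    rw [Real.norm_eq_abs, abs_mul]
    have h1 := abs_trTerm_le (hK xu.2) hδ.le xu.1
    -- `abs_trTerm_le`: `|Σ_a K x x a a| ≤ |F|·C_u·e^{−(δ/2)|p−u|}·e^{−(δ/2)|x−p|}` with `C_u = c₀ e^{−(δ/2)|p′−u|}`
    have h2 : |∑ a, comp Z (T xu.2) xu.1 xu.1 a a|
        ≤ (Fintype.card F : ℝ) * c₀ * (Real.exp (-(δ / 2) * l1 (xu.1 - p)) * Real.exp (-(δ / 2) * l1 (p' - xu.2))) := by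
      refine h1.trans ?_
      have he : Real.exp (-(δ / 2) * l1 (p - xu.2)) ≤ 1 := by
        rw [Real.exp_le_one_iff]; nlinarith [l1_nonneg (p - xu.2)]
      have h0 : 0 ≤ (Fintype.card F : ℝ) * (c₀ * Real.exp (-(δ / 2) * l1 (p' - xu.2))) *
          Real.exp (-(δ / 2) * l1 (xu.1 - p)) := by positivity
      calc (Fintype.card F : ℝ) * (c₀ * Real.exp (-(δ / 2) * l1 (p' - xu.2))) * Real.exp (-(δ / 2) * l1 (p - xu.2)) *
            Real.exp (-(δ / 2) * l1 (xu.1 - p))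
          ≤ (Fintype.card F : ℝ) * (c₀ * Real.exp (-(δ / 2) * l1 (p' - xu.2))) * 1 *
            Real.exp (-(δ / 2) * l1 (xu.1 - p)) := by gcongr
        _ = _ := by ring
    calc |w xu.2| * |∑ a, comp Z (T xu.2) xu.1 xu.1 a a|
        ≤ Cw * ((Fintype.card F : ℝ) * c₀ * (Real.exp (-(δ / 2) * l1 (xu.1 - p)) * Real.exp (-(δ / 2) * l1 (p' - xu.2)))) :=
          mul_le_mul (hw xu.2) h2 (abs_nonneg _) hCw
      _ = Cw * ((Fintype.card F : ℝ) * c₀) * (Real.exp (-(δ / 2) * l1 (xu.1 - p)) * Real.exp (-(δ / 2) * l1 (p' - xu.2))) := by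
          ring

end Trace



end Summit.QuantumFields.BalabanUV.Beta.FP.RepAlgebraTrace

end
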